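import Literature.AnabelianGeometry.EtaleTheta.ConstantMultipleRigidityUniqueProofs
import Literature.AnabelianGeometry.EtaleTheta.ClassicalThetaValueOrders
import HarnessLib

/-!
# [EtTh] Def. 1.9 / Thm. 1.10 (i): the MODEL-LEVEL discharge of the value formulas at `τ`, `τ⁻¹`
# (cell sub-DAG `plan/L2/SUBDAG-EtTh-Thm110.md`, row T110.i.r8: V1″ `StandardValuesFormulaSigned`,
# (b₂) `StandardValuesInvSymm`; «ROW abc-iut-L2-t6 g4 = K2 (T)», abc-iut-L2-lead 2026-08-26T02:11:35Z)

S. Mochizuki, *The étale theta function and its Frobenioid-theoretic manifestations*, Publ. RIMS **45**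
(2009), §1, Def. 1.9 (i)(ii) and Thm. 1.10 (i)(ii), PRIMS PDF pp. 29–30 (printed 255–256), with
Prop. 1.4 (ii)(iii) p. 22 and Def. 1.7 p. 27 [cite: MochizukiEtTh2009, Def 1.9 (i) p.29]. Layer L2 of the
abc-iut cell, seat abc-iut-L2-t6 (gen 4). PROOF-ONLY (no `def`, no named fact) over
`ConstantMultipleRigidity` (`MuTwoSetting.thetaOrbit`, `valuesAt`, abc-iut-L2-t1),
`ConstantMultipleRigiditySub` (the K2 intermediate statements, abc-iut-w5-d140) and this seat's
`ClassicalThetaValueOrders` (the `Θ̈`-value laws).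

WHAT IS PROVED. For a class `x ∈ H¹(Π^tp_Ÿ, Δ_Θ)` (the étale theta class `η̈^Θ`), the set of values at
`τ` (resp. `τ⁻¹`) of its `Π^tp_Ẋ/Π^tp_Ÿ ≅ ℤ`-orbit `η̈^{Θ,ℤ}` (Def. 1.9 (i)) is computed from FOUR
NAMED BINDERS — the sentences of the printed proof («Now assertion (ii) follows immediately», p. 256;
«[cf. Proposition 1.4, (iii)]», p. 255) that the §1 interface cannot see (`NonCuspidalPoint.evalAt` and
`StandardData.tau` are free data; abc-iut-L2-t1 INBOX 2026-08-26T01:45:14Z V1/V2):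
* (B1/B5) GEOMETRY OF `Ÿ → Ẋ`: points `τ_a` of `Ÿ` (`a ∈ ℤ`) lying over `τ` with coordinates
  `Ü(τ_a) = (s·q̈)^a · √−1`, where `s ∈ {1, −1}` records the choice of `ε_Z ∈ {[q̈], [−q̈]} ⊆ Gal(Ẍ/X)`
  of Def. 1.7 («a nontrivial element `ε_Z` … which is `≠ ε_μ`» — both are admissible; `Ẋ = Ẍ/ε_Z` is
  the Tate curve `𝔾_m/(s q̈)^ℤ`); over `τ⁻¹` the coordinates are `(s·q̈)^a · (√−1)⁻¹`;
* (B2) `Π^tp_Ẋ/Π^tp_Ÿ ≅ ℤ` (p. 255 l.−4): a generator `σ₁` of the orbit group modulo `Π^tp_Ÿ`;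
* (B3) NATURALITY OF EVALUATION: the value at `τ` of the translate `conj(σ₁^a) x` is the value of `x` at
  `τ_a` («γ maps the decomposition group of points over τ to …», the formal half of «(ii) follows
  immediately»);
* (B4) Prop. 1.4 (iii) FOR THE SINGLE CLASS `x`: its value at `τ_a` is `c · Θ̈(Ü(τ_a))` for one constant
  `c` (the `O^×`-multiple `η̈^Θ = κ(c·Θ̈)`; the interface's `Prop14iiiValues` gives this only up to a
  point-dependent unit).
From these: `thetaOrbit_eq_range_conj_zpow` (the orbit is `{conj(σ₁^a) x}`: inner classes act
trivially, `ContH1.conj_eq_self_of_mem`), `mem_valuesAt_iff_exists_zpow`, and the two targets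
**`standardValuesFormulaSigned_of_dictionary :
StandardValuesFormulaSigned hC εZ S x`** (V1″, K2 v3, abc-iut-w5-d140 2026-08-26T02:37Z:
`valuesAt(x, τ) = {s^a q̈^{−a²} v₀ | a ∈ ℤ}`, `v₀ = c·Θ̈(√−1)` the value of `x` itself) and
**`standardValuesInvSymm_of_dictionary : StandardValuesInvSymm hC εZ S x`** (the values at `τ⁻¹` are the negatives of those at `τ`), via the
series laws `Θ̈((s q̈)^a ζ) = s^a q̈^{−a²} Θ̈(ζ)` (`thetaDdot_sign_mul_zpow_mul_of_sq_eq_neg_one`, from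
`thetaDdot_zpow_mul_of_sq_eq_neg_one` + oddness) and `Θ̈(−Ü) = −Θ̈(Ü)`. On the branch `s = 1` the
unsigned V1′ `StandardValuesFormula` follows (`standardValuesFormula_of_dictionary`); on `s = −1` it is
false (finding F-L2t6g4-1: `not_exists_zpow_mul_eq_neg`).
HONEST FRAMING: conditional on the four binders (interface-invisible printed sentences, to be GAP rows
of the cell); typed ≠ proved for [EtTh]; nothing here bears on the disputed [IUTchIII] Cor. 3.12.
-/

noncomputable section

namespace Literature.AnabelianGeometry.EtaleTheta

open Literature.AnabelianGeometry.SemiGraphs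

/-! ### Series level: the value law on both branches `s = ±1` -/

section Series

variable {𝕜 : Type*} [NormedField 𝕜] {q2 ζ : 𝕜}

/-- **The value law on the fibre of `Ÿ → Ẋ = 𝔾_m/(s q̈)^ℤ` over `τ`** (both branches of `ε_Z` at once):
for `ζ² = −1`, `q̈ ≠ 0`, `s = ±1`, `Θ̈((s q̈)^a · ζ) = s^a · q̈^{−a²} · Θ̈(ζ)` — Prop. 1.4 (ii) at the
`μ₄`-points (`thetaDdot_zpow_mul_of_sq_eq_neg_one`: the factors `(−1)^a ζ^{−2a}` cancel) and
`Θ̈(−Ü) = −Θ̈(Ü)`; the branch sign `s^a` survives. [cite: MochizukiEtTh2009, Prop 1.4 (ii) p.22] -/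
theorem thetaDdot_sign_mul_zpow_mul_of_sq_eq_neg_one (hζ : ζ ^ 2 = -1) (hq0 : q2 ≠ 0) {s : 𝕜}
    (hs : s = 1 ∨ s = -1) (a : ℤ) :
    thetaDdot q2 ((s * q2) ^ a * ζ) = s ^ a * q2 ^ (-(a * a)) * thetaDdot q2 ζ := by
  rcases hs with rfl | rfl
  · rw [one_mul, one_zpow, one_mul, thetaDdot_zpow_mul_of_sq_eq_neg_one hζ hq0]
  · have hζ' : ((-1 : 𝕜) ^ a * ζ) ^ 2 = -1 := by
      rw [mul_pow, ← zpow_natCast, ← zpow_mul, hζ, mul_comm a, zpow_mul]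
      norm_num
    rw [mul_zpow, show (-1 : 𝕜) ^ a * q2 ^ a * ζ = q2 ^ a * ((-1) ^ a * ζ) by ring,
      thetaDdot_zpow_mul_of_sq_eq_neg_one hζ' hq0]
    have hodd : thetaDdot q2 ((-1 : 𝕜) ^ a * ζ) = (-1) ^ a * thetaDdot q2 ζ := by
      rcases Int.even_or_odd a with ha | ha
      · rw [ha.neg_one_zpow, one_mul, one_mul]
      · rw [ha.neg_one_zpow, neg_one_mul, neg_one_mul, thetaDdot_neg]
    rw [hodd]
    ring

/-- The same over `τ⁻¹` (coordinate `ζ⁻¹ = −ζ`): `Θ̈((s q̈)^a · ζ⁻¹) = −(s^a · q̈^{−a²} · Θ̈(ζ))`.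
[cite: MochizukiEtTh2009, Prop 1.4 (ii) p.22] -/
theorem thetaDdot_sign_mul_zpow_mul_inv_of_sq_eq_neg_one (hζ : ζ ^ 2 = -1) (hq0 : q2 ≠ 0) {s : 𝕜}
    (hs : s = 1 ∨ s = -1) (a : ℤ) :
    thetaDdot q2 ((s * q2) ^ a * ζ⁻¹) = -(s ^ a * q2 ^ (-(a * a)) * thetaDdot q2 ζ) := by
  rw [inv_eq_neg_of_sq_eq_neg_one hζ, mul_neg, thetaDdot_neg,
    thetaDdot_sign_mul_zpow_mul_of_sq_eq_neg_one hζ hq0 hs]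

/-- **Finding F-L2t6g4-1 in kernel form**: on the branch `s = −1` the `a = 1` value
`−q̈^{−1}·v₀` is NOT of the unsigned form `q̈^{−b²}·v₀` (`0 < ‖q̈‖ < 1`, `v₀ ≠ 0`, `2 ≠ 0`) — so the
unsigned V1′ `StandardValuesFormula` fails there while V1″ holds. [cite: MochizukiEtTh2009, Def 1.7 p.27] -/
theorem not_exists_zpow_mul_eq_neg (hq0 : 0 < ‖q2‖) (hq : ‖q2‖ < 1) {v₀ : 𝕜} (hv : v₀ ≠ 0)
    (h2 : (2 : 𝕜) ≠ 0) : ¬ ∃ b : ℤ, q2 ^ (-(b * b)) * v₀ = -(q2 ^ (-(1 : ℤ)) * v₀) := by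
  rintro ⟨b, hb⟩
  have hq0' : q2 ≠ 0 := norm_pos_iff.mp hq0
  have hn : ‖q2‖ ^ (-(b * b)) = ‖q2‖ ^ (-(1 : ℤ)) := by
    have := congrArg (fun x => ‖x‖) hb
    simp only [norm_mul, norm_zpow, norm_neg] at this
    exact mul_right_cancel₀ (norm_ne_zero_iff.mpr hv) this
  have hbb : -(b * b) = -(1 : ℤ) := zpow_right_injective₀ hq0 hq.ne hn
  rw [hbb] at hb
  have h0 : (2 : 𝕜) * (q2 ^ (-(1 : ℤ)) * v₀) = 0 := by linear_combination hb
  rcases mul_eq_zero.mp h0 with h | h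
  · exact h2 h
  · exact mul_ne_zero (zpow_ne_zero _ hq0') hv h

end Series

/-! ### Model level: the orbit through a generator, and the values at `τ`, `τ⁻¹` -/

namespace MuTwoSetting

variable {p : ℕ} [Fact p.Prime] {M : MuTwoSetting p}

/-- Coercion `K̈^× → ℚ̄_p` is injective (bookkeeping). [cite: MochizukiEtTh2009, §1 p.17] -/
theorem coe_units_injective {v w : (↥M.Kdd)ˣ}
    (h : ((v : M.Kdd) : PadicAlgCl p) = ((w : M.Kdd) : PadicAlgCl p)) : v = w :=
  Units.ext (Subtype.ext h)

/-- **(B2) ⇒ the orbit through a generator**: if `σ₁` generates the orbit group `Π^tp_Ẋ` modulo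
`Π^tp_Ÿ` (every `σ` with `inclX σ ∈ Π^tp_Ẋ` is `σ₁^a · h`, `h ∈ Π^tp_Ÿ`), then the orbit `η̈^{Θ,ℤ}` of
`x` is `{conj(σ₁^a) x | a ∈ ℤ}` — the inner classes `h ∈ Π^tp_Ÿ` act trivially on `H¹(Π^tp_Ÿ, Δ_Θ)`
(`ContH1.conj_eq_self_of_mem`); «the `Π^tp_Ẋ/Π^tp_Ÿ ≅ ℤ`-orbit of `η̈^Θ`» (p. 255).
[cite: MochizukiEtTh2009, Def 1.9 p.29] -/
theorem thetaOrbit_eq_range_conj_zpow (hC : M.toThetaSetting.Compat) (εZ : M.GtpC)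
    {σ₁ : M.PiTemp} (hσ₁ : M.inclX σ₁ ∈ M.dotX εZ)
    (hgen : ∀ σ : M.PiTemp, M.inclX σ ∈ M.dotX εZ →
      ∃ (a : ℤ) (h : M.PiTemp), h ∈ M.toThetaSetting.GtpYdd ∧ σ = σ₁ ^ a * h)
    (x : M.toThetaSetting.H1 M.toThetaSetting.GtpYdd) :
    (haveI := hC.GtpYdd_normal
     M.thetaOrbit hC εZ x =
      Set.range fun a : ℤ => ContH1.conj M.toTheta M.toThetaSetting.DeltaTheta (σ₁ ^ a) x) := by
  haveI := hC.GtpYdd_normal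
  ext y
  constructor
  · rintro ⟨σ, hσ, rfl⟩
    obtain ⟨a, h, hh, rfl⟩ := hgen σ hσ
    exact ⟨a, by rw [ContH1.conj_mul_apply, ContH1.conj_eq_self_of_mem h hh]⟩
  · rintro ⟨a, rfl⟩
    exact ⟨σ₁ ^ a, by rw [map_zpow]; exact Subgroup.zpow_mem _ hσ₁ a, rfl⟩

variable {E : M.toThetaSetting.KummerData}

/-- **(B2)+(B3) ⇒ the values through a generator**: with `σ₁` as above and the NATURALITY binder
«the value at `y₀` of `conj(σ₁^a) x` is the value of `x` at the point `y_a`», the set of values of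
`η̈^{Θ,ℤ}` at `y₀` is `{v | ∃ a, evalAt_{y_a}(x|_{y_a}) = v}`. [cite: MochizukiEtTh2009, Def 1.9 (i) p.29] -/
theorem mem_valuesAt_iff_exists_zpow (hC : M.toThetaSetting.Compat) (εZ : M.GtpC)
    {σ₁ : M.PiTemp} (hσ₁ : M.inclX σ₁ ∈ M.dotX εZ)
    (hgen : ∀ σ : M.PiTemp, M.inclX σ ∈ M.dotX εZ →
      ∃ (a : ℤ) (h : M.PiTemp), h ∈ M.toThetaSetting.GtpYdd ∧ σ = σ₁ ^ a * h)
    (x : M.toThetaSetting.H1 M.toThetaSetting.GtpYdd) (y₀ : ThetaSetting.NonCuspidalPoint E)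
    (y : ℤ → ThetaSetting.NonCuspidalPoint E)
    (hnat : haveI := hC.GtpYdd_normal
      ∀ a : ℤ, y₀.evalAt (ContH1.res M.toTheta M.toThetaSetting.DeltaTheta y₀.Dpt_le
          (ContH1.conj M.toTheta M.toThetaSetting.DeltaTheta (σ₁ ^ a) x)) =
        (y a).evalAt (ContH1.res M.toTheta M.toThetaSetting.DeltaTheta (y a).Dpt_le x))
    (v : (↥M.Kdd)ˣ) :
    v ∈ valuesAt hC εZ x y₀ ↔
      ∃ a : ℤ, (y a).evalAt (ContH1.res M.toTheta M.toThetaSetting.DeltaTheta (y a).Dpt_le x) =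
        E.toKddHat v := by
  haveI := hC.GtpYdd_normal
  constructor
  · rintro ⟨z, hz, hv⟩
    rw [thetaOrbit_eq_range_conj_zpow hC εZ hσ₁ hgen x] at hz
    obtain ⟨a, rfl⟩ := hz
    exact ⟨a, by rw [← hnat a, hv]⟩
  · rintro ⟨a, ha⟩
    refine ⟨ContH1.conj M.toTheta M.toThetaSetting.DeltaTheta (σ₁ ^ a) x, ?_, by rw [hnat a, ha]⟩
    rw [thetaOrbit_eq_range_conj_zpow hC εZ hσ₁ hgen x]
    exact ⟨a, rfl⟩

/-- **V1″ `StandardValuesFormulaSigned` at the model, from the dictionary (B1)–(B5)**: for a class `x` whose values at the points `τ_a` over `τ`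
(`Ü(τ_a) = (s q̈)^a √−1`, `s = ±1` the branch of `ε_Z`) are `c · Θ̈(Ü(τ_a))` (Prop. 1.4 (iii) for the
single class) and whose translates evaluate naturally (B3), the values at `τ` of `η̈^{Θ,ℤ}` are EXACTLY
`{s^a · q̈^{−a²} · v₀ | a ∈ ℤ}`, `v₀ = c · Θ̈(√−1)` the value of `x` itself at `τ` — Def. 1.9 (i) with
«the series representation of Proposition 1.4» made explicit. [cite: MochizukiEtTh2009, Def 1.9 (i) p.29] -/
theorem standardValuesFormulaSigned_of_dictionary (hC : M.toThetaSetting.Compat) (εZ : M.GtpC)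
    (S : M.StandardData E) (x : M.toThetaSetting.H1 M.toThetaSetting.GtpYdd)
    {σ₁ : M.PiTemp} (hσ₁ : M.inclX σ₁ ∈ M.dotX εZ)
    (hgen : ∀ σ : M.PiTemp, M.inclX σ ∈ M.dotX εZ →
      ∃ (a : ℤ) (h : M.PiTemp), h ∈ M.toThetaSetting.GtpYdd ∧ σ = σ₁ ^ a * h)
    (τ_ : ℤ → ThetaSetting.NonCuspidalPoint E)
    (hnat : haveI := hC.GtpYdd_normal
      ∀ a : ℤ, S.tau.evalAt (ContH1.res M.toTheta M.toThetaSetting.DeltaTheta S.tau.Dpt_le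
          (ContH1.conj M.toTheta M.toThetaSetting.DeltaTheta (σ₁ ^ a) x)) =
        (τ_ a).evalAt (ContH1.res M.toTheta M.toThetaSetting.DeltaTheta (τ_ a).Dpt_le x))
    {s : PadicAlgCl p} (hs : s = 1 ∨ s = -1)
    (hcoord : ∀ a : ℤ, (((τ_ a).coord : M.Kdd) : PadicAlgCl p) =
      (s * M.toThetaSetting.qdd) ^ a * S.sqrtNegOne)
    {c : PadicAlgCl p} (val : ℤ → (↥M.Kdd)ˣ)
    (hval : ∀ a : ℤ, ((val a : M.Kdd) : PadicAlgCl p) =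
      c * thetaDdot M.toThetaSetting.qdd (((τ_ a).coord : M.Kdd) : PadicAlgCl p))
    (heval : ∀ a : ℤ, (τ_ a).evalAt (ContH1.res M.toTheta M.toThetaSetting.DeltaTheta (τ_ a).Dpt_le x) =
      E.toKddHat (val a)) :
    StandardValuesFormulaSigned hC εZ S x := by
  haveI := hC.GtpYdd_normal
  have hq0 : M.toThetaSetting.qdd ≠ 0 := qdd_ne_zero
  -- the values at the points `τ_a` in closed form
  have hvala : ∀ a : ℤ, ((val a : M.Kdd) : PadicAlgCl p) =
      s ^ a * M.toThetaSetting.qdd ^ (-(a * a)) * ((val 0 : M.Kdd) : PadicAlgCl p) := by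
    intro a
    rw [hval a, hval 0, hcoord a, hcoord 0, zpow_zero, one_mul,
      thetaDdot_sign_mul_zpow_mul_of_sq_eq_neg_one S.sqrtNegOne_sq hq0 hs]
    ring
  refine ⟨val 0, s, hs, ?_, fun v => ?_⟩
  · -- the value of `x` itself: `a = 0` in (B3)
    have h := hnat 0
    rwa [zpow_zero, ContH1.conj_one_apply, heval 0] at h
  · rw [mem_valuesAt_iff_exists_zpow hC εZ hσ₁ hgen x S.tau τ_ hnat v]
    constructor
    · rintro ⟨a, ha⟩
      refine ⟨a, ?_⟩
      rw [heval a] at ha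
      rw [← E.toKddHat_injective ha, hvala a]
    · rintro ⟨a, ha⟩
      refine ⟨a, ?_⟩
      rw [heval a, ← hvala a] at *
      rw [coe_units_injective ha.symm]

/-- **On the branch `s = 1` (`ε_Z = [q̈]`) the unsigned V1′ `StandardValuesFormula` holds at the model**
(same dictionary). On `s = −1` it does not (`not_exists_zpow_mul_eq_neg`, finding F-L2t6g4-1).
[cite: MochizukiEtTh2009, Def 1.9 (i) p.29] -/
theorem standardValuesFormula_of_dictionary (hC : M.toThetaSetting.Compat) (εZ : M.GtpC)
    (S : M.StandardData E) (x : M.toThetaSetting.H1 M.toThetaSetting.GtpYdd)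
    {σ₁ : M.PiTemp} (hσ₁ : M.inclX σ₁ ∈ M.dotX εZ)
    (hgen : ∀ σ : M.PiTemp, M.inclX σ ∈ M.dotX εZ →
      ∃ (a : ℤ) (h : M.PiTemp), h ∈ M.toThetaSetting.GtpYdd ∧ σ = σ₁ ^ a * h)
    (τ_ : ℤ → ThetaSetting.NonCuspidalPoint E)
    (hnat : haveI := hC.GtpYdd_normal
      ∀ a : ℤ, S.tau.evalAt (ContH1.res M.toTheta M.toThetaSetting.DeltaTheta S.tau.Dpt_le
          (ContH1.conj M.toTheta M.toThetaSetting.DeltaTheta (σ₁ ^ a) x)) =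
        (τ_ a).evalAt (ContH1.res M.toTheta M.toThetaSetting.DeltaTheta (τ_ a).Dpt_le x))
    (hcoord : ∀ a : ℤ, (((τ_ a).coord : M.Kdd) : PadicAlgCl p) =
      M.toThetaSetting.qdd ^ a * S.sqrtNegOne)
    {c : PadicAlgCl p} (val : ℤ → (↥M.Kdd)ˣ)
    (hval : ∀ a : ℤ, ((val a : M.Kdd) : PadicAlgCl p) =
      c * thetaDdot M.toThetaSetting.qdd (((τ_ a).coord : M.Kdd) : PadicAlgCl p))
    (heval : ∀ a : ℤ, (τ_ a).evalAt (ContH1.res M.toTheta M.toThetaSetting.DeltaTheta (τ_ a).Dpt_le x) =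
      E.toKddHat (val a)) :
    StandardValuesFormula hC εZ S x := by
  refine ⟨val 0, ?_, fun v => ?_⟩
  · have h := hnat 0
    haveI := hC.GtpYdd_normal
    rwa [zpow_zero, ContH1.conj_one_apply, heval 0] at h
  · have hq0 : M.toThetaSetting.qdd ≠ 0 := qdd_ne_zero
    have hvala : ∀ a : ℤ, ((val a : M.Kdd) : PadicAlgCl p) =
        M.toThetaSetting.qdd ^ (-(a * a)) * ((val 0 : M.Kdd) : PadicAlgCl p) := by
      intro a
      rw [hval a, hval 0, hcoord a, hcoord 0, zpow_zero, one_mul,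
        thetaDdot_zpow_mul_of_sq_eq_neg_one S.sqrtNegOne_sq hq0]
      ring
    haveI := hC.GtpYdd_normal
    rw [mem_valuesAt_iff_exists_zpow hC εZ hσ₁ hgen x S.tau τ_ hnat v]
    constructor
    · rintro ⟨a, ha⟩
      refine ⟨a, ?_⟩
      rw [heval a] at ha
      rw [← E.toKddHat_injective ha, hvala a]
    · rintro ⟨a, ha⟩
      refine ⟨a, ?_⟩
      rw [heval a, ← hvala a] at *
      rw [coe_units_injective ha.symm]

/-- **(b₂) `StandardValuesInvSymm` at the model, from the dictionary at `τ` AND at `τ⁻¹`**: with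
points `τ_a` over `τ` (coordinates `(s q̈)^a √−1`) and `τ'_a` over `τ⁻¹` (coordinates
`(s q̈)^a (√−1)⁻¹ = −(s q̈)^a √−1`), naturality at both, and the single-class value law `c · Θ̈(Ü(·))` at
all of them, the values at `τ⁻¹` are exactly the negatives of the values at `τ` (`Θ̈(−Ü) = −Θ̈(Ü)`,
Prop. 1.4 (ii)) — «the 4-torsion point `τ⁻¹` determined by `−√−1` admits a similar description»
(Def. 1.9). [cite: MochizukiEtTh2009, Def 1.9 (i) p.29] -/
theorem standardValuesInvSymm_of_dictionary (hC : M.toThetaSetting.Compat) (εZ : M.GtpC)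
    (S : M.StandardData E) (x : M.toThetaSetting.H1 M.toThetaSetting.GtpYdd)
    {σ₁ : M.PiTemp} (hσ₁ : M.inclX σ₁ ∈ M.dotX εZ)
    (hgen : ∀ σ : M.PiTemp, M.inclX σ ∈ M.dotX εZ →
      ∃ (a : ℤ) (h : M.PiTemp), h ∈ M.toThetaSetting.GtpYdd ∧ σ = σ₁ ^ a * h)
    (τ_ τ'_ : ℤ → ThetaSetting.NonCuspidalPoint E)
    (hnat : haveI := hC.GtpYdd_normal
      ∀ a : ℤ, S.tau.evalAt (ContH1.res M.toTheta M.toThetaSetting.DeltaTheta S.tau.Dpt_le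
          (ContH1.conj M.toTheta M.toThetaSetting.DeltaTheta (σ₁ ^ a) x)) =
        (τ_ a).evalAt (ContH1.res M.toTheta M.toThetaSetting.DeltaTheta (τ_ a).Dpt_le x))
    (hnat' : haveI := hC.GtpYdd_normal
      ∀ a : ℤ, S.tauInv.evalAt (ContH1.res M.toTheta M.toThetaSetting.DeltaTheta S.tauInv.Dpt_le
          (ContH1.conj M.toTheta M.toThetaSetting.DeltaTheta (σ₁ ^ a) x)) =
        (τ'_ a).evalAt (ContH1.res M.toTheta M.toThetaSetting.DeltaTheta (τ'_ a).Dpt_le x))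
    {s : PadicAlgCl p} (hs : s = 1 ∨ s = -1)
    (hcoord : ∀ a : ℤ, (((τ_ a).coord : M.Kdd) : PadicAlgCl p) =
      (s * M.toThetaSetting.qdd) ^ a * S.sqrtNegOne)
    (hcoord' : ∀ a : ℤ, (((τ'_ a).coord : M.Kdd) : PadicAlgCl p) =
      (s * M.toThetaSetting.qdd) ^ a * S.sqrtNegOne⁻¹)
    {c : PadicAlgCl p} (val val' : ℤ → (↥M.Kdd)ˣ)
    (hval : ∀ a : ℤ, ((val a : M.Kdd) : PadicAlgCl p) =
      c * thetaDdot M.toThetaSetting.qdd (((τ_ a).coord : M.Kdd) : PadicAlgCl p))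
    (hval' : ∀ a : ℤ, ((val' a : M.Kdd) : PadicAlgCl p) =
      c * thetaDdot M.toThetaSetting.qdd (((τ'_ a).coord : M.Kdd) : PadicAlgCl p))
    (heval : ∀ a : ℤ, (τ_ a).evalAt (ContH1.res M.toTheta M.toThetaSetting.DeltaTheta (τ_ a).Dpt_le x) =
      E.toKddHat (val a))
    (heval' : ∀ a : ℤ,
      (τ'_ a).evalAt (ContH1.res M.toTheta M.toThetaSetting.DeltaTheta (τ'_ a).Dpt_le x) =
        E.toKddHat (val' a)) :
    StandardValuesInvSymm hC εZ S x := by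
  haveI := hC.GtpYdd_normal
  have hq0 : M.toThetaSetting.qdd ≠ 0 := qdd_ne_zero
  -- the values at `τ'_a` are the negatives of those at `τ_a`
  have hneg : ∀ a : ℤ, ((val' a : M.Kdd) : PadicAlgCl p) = -((val a : M.Kdd) : PadicAlgCl p) := by
    intro a
    rw [hval' a, hval a, hcoord' a, hcoord a,
      thetaDdot_sign_mul_zpow_mul_inv_of_sq_eq_neg_one S.sqrtNegOne_sq hq0 hs,
      thetaDdot_sign_mul_zpow_mul_of_sq_eq_neg_one S.sqrtNegOne_sq hq0 hs, mul_neg]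
  intro v
  rw [mem_valuesAt_iff_exists_zpow hC εZ hσ₁ hgen x S.tauInv τ'_ hnat' v]
  constructor
  · rintro ⟨a, ha⟩
    refine ⟨val a, ?_, ?_⟩
    · rw [mem_valuesAt_iff_exists_zpow hC εZ hσ₁ hgen x S.tau τ_ hnat (val a)]
      exact ⟨a, heval a⟩
    · rw [heval' a] at ha
      rw [← E.toKddHat_injective ha, hneg a]
  · rintro ⟨w, hw, hvw⟩
    rw [mem_valuesAt_iff_exists_zpow hC εZ hσ₁ hgen x S.tau τ_ hnat w] at hw
    obtain ⟨a, ha⟩ := hw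
    refine ⟨a, ?_⟩
    rw [heval a] at ha
    have hw' : w = val a := E.toKddHat_injective ha.symm
    rw [heval' a]
    congr 1
    apply coe_units_injective
    rw [hneg a, hvw, hw']

end MuTwoSetting

end Literature.AnabelianGeometry.EtaleTheta

end
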